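import Summits.HodgeConjecture.HodgeConjecture.Cruxes.BlochSeedDiscOne.TwoAdicMuLaw

/-!
# SlotLatticeLaw — the SLOT LATTICE of integer (A1)-clean designs: `q_d ∈ 2^⌈d/2⌉ ℤ` (plan-lens-HodgeAV-strengthen g13, MEMO-19)

Token: line stmt-HodgeConjecture-18881 Cruxes/BlochSeedDiscOne/Lines/birth.lean 814a6a70c14e831a stub_rung_pad4_seedAt.

STATUS WORD.  A kernel theorem about the LETTER model of `DepthBoundA4.lean` (letters ≠ sheaves ≠ a SEED); evidence-grade; nothing here is
proved toward HC ∕ HC_CM ∕ HC_AV ∕ №4 ∕ 26512 ∕ 18881 ∕ H2, nor toward `FloorFree 6 199 8` ∕ `Nonex 14 199 8`.  It is the integrality-carrying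
finite letter calculus the lens was asked for (director-hodge R19.480 (3)), on the 2-adic axis, and it is a LATTICE, not a floor: it constrains the
INTEGER points of the class model (memo: 14 ∕ 14 integer class points of record violate it), it cannot force `μ = 0` at `≤ 199` copies
(`I2CongruenceCensus.budget_digits`).

THE LAW.  Let `D` be an integer two-term design (`DepthBoundA4.Design`, class tensor `T = Σ_N − Σ_P`) on the height-`h` alphabet.
* (slot agreement, any `h`) (A1).2 makes every e-free word of degree `d` carry the same INTEGER `q_d := D.Tz w`; in particular the S₄-orbit sum of
  the degree-1 words is `T(h111) + T(1h11) + T(11h1) + T(111h) = 4·q₁` — the functional `Σ_cells ν_c·(a₀+a₁+a₂+a₃)` of the design lies in `4ℤ`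
  (`levelSum_eq_four_mul`), a row the S₄-orbit-summed (multiset) class model of record does not have (its six agreement rows are the RATIOS in
  degrees 2–6; degree 1 has no partner multiset).
* (LAYER A, `h` even: `n = a² − x² − y² ≡ a + x + y ≡ h (mod 2)`) `q_{2j} = T(p^j 1…) ∈ 2^j ℤ`, `q_{2j+1} = T(p^j h 1…) ∈ 2^j ℤ`.
* (LAYER B, the MIXED rows — invisible to every LP by torus symmetrisation) `T(p^j, e, 1, …) = Σ ν (Π_{i<j} n_i)·β̄_j = 0` EXACTLY, so its real and
  (minus) imaginary parts `Σ ν (Π n_i) x_j`, `Σ ν (Π n_i) y_j` vanish; with `a_j = (a_j + x_j + y_j − h) − x_j − y_j + h` and `2 ∣ a + x + y − h` on the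
  alphabet: `q_{2j+1} = Σ ν (Π n_i) a_j ∈ 2^{j+1} ℤ` at even `h`.  Hence **`q₁ ∈ 2ℤ, q₃ ∈ 4ℤ, q₅ ∈ 8ℤ, q₇ ∈ 16ℤ`**, i.e. `q_d ∈ 2^⌈d/2⌉ ℤ` for
  `d = 1 … 8` (`slotLattice_holds`), and at any `h`: `q₁ ≡ h·rank (mod 2)` (`two_dvd_q1_sub`).
* (the 175-point) the least integer point of region 4273's multiset class model (idea-crit-hsem-4 g9 memo-105; ×2 check-class-1 BATCH 180) has
  level-sum functional `1266 − 520 = 746 ∉ 4ℤ` (`levelSum175`, `not_four_dvd_746`): it is not the orbit sum of any integer slot-resolved design with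
  (A1).2 (`no_design_has_levelSum_746`).  The other 13 T13 least points fail the same way (memo table; plain arithmetic).

No `sorry`, no new axioms, no `instance`, no `notation`, no `native_decide`; imports `TwoAdicMuLaw` (for `wsum` ∕ `Tf` bookkeeping) and through it
`DepthBoundA4` (the model of record: `Letter`, `Design`, `Design.T`, `Design.Tz`, `Design.A1`, `linZ`, `icellCoef`, `T_eq_cast_Tz`, `Tz_eq_of_A1`).
-/

namespace Summit.HodgeConjecture.HodgeConjecture.Cruxes.BlochSeedDiscOne.SlotLatticeLaw

open Summit.HodgeConjecture.HodgeConjecture.Cruxes.BlochSeedDiscOne.DepthBoundA4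
open Summit.HodgeConjecture.HodgeConjecture.Cruxes.BlochSeedDiscOne.TwoAdicMuLaw

/-! ## §1 Letter parities on the height-`h` alphabet -/

/-- On the height-`h` alphabet `a + x + y ≡ h (mod 2)`. -/
theorem letter_parity (h : ℤ) (ℓ : Letter) (hℓ : ℓ.OnAlphabet h) : (2 : ℤ) ∣ ℓ.a + ℓ.x + ℓ.y - h := by
  obtain ⟨hh, _⟩ := hℓ
  unfold Letter.height at hh
  rcases abs_choice ℓ.x with hx | hx <;> rcases abs_choice ℓ.y with hy | hy <;> rw [hx, hy] at hh
  · exact ⟨0, by omega⟩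
  · exact ⟨ℓ.y, by omega⟩
  · exact ⟨ℓ.x, by omega⟩
  · exact ⟨ℓ.x + ℓ.y, by omega⟩

theorem two_dvd_sq_sub_self (z : ℤ) : (2 : ℤ) ∣ z ^ 2 - z := by
  have e : z ^ 2 - z = z * (z - 1) := by ring
  rw [e, ← even_iff_two_dvd]
  exact Int.even_mul_pred_self z

/-- At even height every letter has even self-intersection `n = a² − x² − y²`. -/
theorem two_dvd_selfInt (h : ℤ) (hh : (2 : ℤ) ∣ h) (ℓ : Letter) (hℓ : ℓ.OnAlphabet h) : (2 : ℤ) ∣ ℓ.selfInt := by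
  have hp := letter_parity h ℓ hℓ
  have e : ℓ.selfInt = (ℓ.a ^ 2 - ℓ.a) - (ℓ.x ^ 2 - ℓ.x) - (ℓ.y ^ 2 - ℓ.y) + (ℓ.a + ℓ.x + ℓ.y - h) - 2 * ℓ.x - 2 * ℓ.y + h := by
    unfold Letter.selfInt Letter.bnorm; ring
  rw [e]
  refine dvd_add (dvd_sub (dvd_sub (dvd_add (dvd_sub (dvd_sub (two_dvd_sq_sub_self _) (two_dvd_sq_sub_self _))
    (two_dvd_sq_sub_self _)) hp) (dvd_mul_right 2 _)) (dvd_mul_right 2 _)) hh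

/-! ## §2 The words `p^j h 1…`, `p^j e 1…`, `p^j 1…` and the degree-1 placements -/

def wH0 : Word := ![Sym.h, Sym.one, Sym.one, Sym.one]
def wH1 : Word := ![Sym.one, Sym.h, Sym.one, Sym.one]
def wH2 : Word := ![Sym.one, Sym.one, Sym.h, Sym.one]
def wH3 : Word := ![Sym.one, Sym.one, Sym.one, Sym.h]
def wE0 : Word := ![Sym.e, Sym.one, Sym.one, Sym.one]
def wPH : Word := ![Sym.pt, Sym.h, Sym.one, Sym.one]
def wPE : Word := ![Sym.pt, Sym.e, Sym.one, Sym.one]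
def wPPH : Word := ![Sym.pt, Sym.pt, Sym.h, Sym.one]
def wPPE : Word := ![Sym.pt, Sym.pt, Sym.e, Sym.one]
def wPPPH : Word := ![Sym.pt, Sym.pt, Sym.pt, Sym.h]
def wPPPE : Word := ![Sym.pt, Sym.pt, Sym.pt, Sym.e]
def wP : Word := ![Sym.pt, Sym.one, Sym.one, Sym.one]
def wPP : Word := ![Sym.pt, Sym.pt, Sym.one, Sym.one]
def wPPP : Word := ![Sym.pt, Sym.pt, Sym.pt, Sym.one]
def wPPPP : Word := ![Sym.pt, Sym.pt, Sym.pt, Sym.pt]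

theorem wH0_efree : wH0.efree := by intro f; fin_cases f <;> rfl
theorem wH1_efree : wH1.efree := by intro f; fin_cases f <;> rfl
theorem wH2_efree : wH2.efree := by intro f; fin_cases f <;> rfl
theorem wH3_efree : wH3.efree := by intro f; fin_cases f <;> rfl
theorem wPH_efree : wPH.efree := by intro f; fin_cases f <;> rfl
theorem wPPH_efree : wPPH.efree := by intro f; fin_cases f <;> rfl
theorem wPPPH_efree : wPPPH.efree := by intro f; fin_cases f <;> rfl
theorem wP_efree : wP.efree := by intro f; fin_cases f <;> rfl
theorem wPP_efree : wPP.efree := by intro f; fin_cases f <;> rfl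
theorem wPPP_efree : wPPP.efree := by intro f; fin_cases f <;> rfl
theorem wPPPP_efree : wPPPP.efree := by intro f; fin_cases f <;> rfl
theorem wH0_deg : wH0.deg = 1 := by decide
theorem wH1_deg : wH1.deg = 1 := by decide
theorem wH2_deg : wH2.deg = 1 := by decide
theorem wH3_deg : wH3.deg = 1 := by decide
theorem wPH_deg : wPH.deg = 3 := by decide
theorem wPPH_deg : wPPH.deg = 5 := by decide
theorem wPPPH_deg : wPPPH.deg = 7 := by decide
theorem wP_deg : wP.deg = 2 := by decide
theorem wPP_deg : wPP.deg = 4 := by decide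
theorem wPPP_deg : wPPP.deg = 6 := by decide
theorem wPPPP_deg : wPPPP.deg = 8 := by decide

/-- The mixed words `p^j e 1…` vanish under (A1).1. -/
theorem mixedE_zero (D : Design) (h1 : D.A1) :
    D.T wE0 = 0 ∧ D.T wPE = 0 ∧ D.T wPPE = 0 ∧ D.T wPPPE = 0 := by
  obtain ⟨hz, _⟩ := h1
  exact ⟨hz wE0 (by unfold Word.efree wE0; decide) (by decide) (by decide),
    hz wPE (by unfold Word.efree wPE; decide) (by decide) (by decide),
    hz wPPE (by unfold Word.efree wPPE; decide) (by decide) (by decide),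
    hz wPPPE (by unfold Word.efree wPPPE; decide) (by decide) (by decide)⟩

/-! ## §3 Per-cell integer functions: prefix products `Π_j = Π_{i<j} n_i` and the slot-`j` moments -/

/-- `Π_j(c) = Π_{i<j} n_i` for `j = 0,1,2,3`. -/
def pre0 (_ : Cell) : ℤ := 1
def pre1 (c : Cell) : ℤ := (c 0).selfInt
def pre2 (c : Cell) : ℤ := (c 0).selfInt * (c 1).selfInt
def pre3 (c : Cell) : ℤ := (c 0).selfInt * (c 1).selfInt * (c 2).selfInt

/-- `A_j = Π_j · a_j`, `X_j = Π_j · x_j`, `Y_j = Π_j · y_j`, `V_j = Π_j · (a_j + x_j + y_j − h)`. -/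
def Aj (p : Cell → ℤ) (j : Fin 4) (c : Cell) : ℤ := p c * (c j).a
def Xj (p : Cell → ℤ) (j : Fin 4) (c : Cell) : ℤ := p c * (c j).x
def Yj (p : Cell → ℤ) (j : Fin 4) (c : Cell) : ℤ := p c * (c j).y
def Vj (h : ℤ) (p : Cell → ℤ) (j : Fin 4) (c : Cell) : ℤ := p c * ((c j).a + (c j).x + (c j).y - h)

theorem Aj_decomp (h : ℤ) (p : Cell → ℤ) (j : Fin 4) (c : Cell) :
    Aj p j c = Vj h p j c - Xj p j c - Yj p j c + h * p c := by
  unfold Aj Vj Xj Yj; ring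

/-- integer cell coefficients of the e-free words. -/
theorem icellCoef_wH0 (c : Cell) : icellCoef c wH0 = Aj pre0 0 c := by
  unfold icellCoef wH0 Aj pre0; simp [Fin.prod_univ_four, Sym.icoef]
theorem icellCoef_wPH (c : Cell) : icellCoef c wPH = Aj pre1 1 c := by
  unfold icellCoef wPH Aj pre1; simp [Fin.prod_univ_four, Sym.icoef]
theorem icellCoef_wPPH (c : Cell) : icellCoef c wPPH = Aj pre2 2 c := by
  unfold icellCoef wPPH Aj pre2; simp [Fin.prod_univ_four, Sym.icoef]
theorem icellCoef_wPPPH (c : Cell) : icellCoef c wPPPH = Aj pre3 3 c := by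
  unfold icellCoef wPPPH Aj pre3; simp [Fin.prod_univ_four, Sym.icoef]
theorem icellCoef_wP (c : Cell) : icellCoef c wP = pre1 c := by
  unfold icellCoef wP pre1; simp [Fin.prod_univ_four, Sym.icoef]
theorem icellCoef_wPP (c : Cell) : icellCoef c wPP = pre2 c := by
  unfold icellCoef wPP pre2; simp [Fin.prod_univ_four, Sym.icoef]
theorem icellCoef_wPPP (c : Cell) : icellCoef c wPPP = pre3 c := by
  unfold icellCoef wPPP pre3; simp [Fin.prod_univ_four, Sym.icoef]
theorem icellCoef_wPPPP (c : Cell) : icellCoef c wPPPP = pre3 c * (c 3).selfInt := by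
  unfold icellCoef wPPPP pre3; simp [Fin.prod_univ_four, Sym.icoef]

/-- Gaussian cell coefficients of the mixed words `p^j e`: real part `X_j`, imaginary part `−Y_j`. -/
theorem cellCoef_wE0 (c : Cell) : cellCoef c wE0 = ⟨Xj pre0 0 c, - Yj pre0 0 c⟩ := by
  unfold cellCoef wE0 Xj Yj pre0
  rw [Zsqrtd.ext_iff]
  simp [Fin.prod_univ_four, Sym.coef, Letter.beta]
theorem cellCoef_wPE (c : Cell) : cellCoef c wPE = ⟨Xj pre1 1 c, - Yj pre1 1 c⟩ := by
  unfold cellCoef wPE Xj Yj pre1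
  rw [Zsqrtd.ext_iff]
  simp [Fin.prod_univ_four, Sym.coef, Letter.beta]
theorem cellCoef_wPPE (c : Cell) : cellCoef c wPPE = ⟨Xj pre2 2 c, - Yj pre2 2 c⟩ := by
  unfold cellCoef wPPE Xj Yj pre2
  rw [Zsqrtd.ext_iff]
  simp [Fin.prod_univ_four, Sym.coef, Letter.beta, Zsqrtd.re_mul, Zsqrtd.im_mul]
theorem cellCoef_wPPPE (c : Cell) : cellCoef c wPPPE = ⟨Xj pre3 3 c, - Yj pre3 3 c⟩ := by
  unfold cellCoef wPPPE Xj Yj pre3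
  rw [Zsqrtd.ext_iff]
  simp [Fin.prod_univ_four, Sym.coef, Letter.beta, Zsqrtd.re_mul, Zsqrtd.im_mul]

/-! ## §4 Integer sums: linearity, divisibility, real and imaginary parts of `T` -/

/-- `Σ_N m·φ − Σ_P m·φ` for an integer cell function. -/
def Lz (D : Design) (φ : Cell → ℤ) : ℤ := linZ D.N φ - linZ D.P φ

theorem linZ_add (L : List (Cell × ℕ)) (φ ψ : Cell → ℤ) : linZ L (fun c => φ c + ψ c) = linZ L φ + linZ L ψ := by
  induction L with
  | nil => simp [linZ]
  | cons a t ih => rw [linZ_cons, linZ_cons, linZ_cons, ih]; ring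

theorem linZ_sub (L : List (Cell × ℕ)) (φ ψ : Cell → ℤ) : linZ L (fun c => φ c - ψ c) = linZ L φ - linZ L ψ := by
  induction L with
  | nil => simp [linZ]
  | cons a t ih => rw [linZ_cons, linZ_cons, linZ_cons, ih]; ring

theorem linZ_mul (L : List (Cell × ℕ)) (k : ℤ) (φ : Cell → ℤ) : linZ L (fun c => k * φ c) = k * linZ L φ := by
  induction L with
  | nil => simp [linZ]
  | cons a t ih => rw [linZ_cons, linZ_cons, ih]; ring

theorem dvd_linZ (L : List (Cell × ℕ)) (φ : Cell → ℤ) (d : ℤ) (h : ∀ cm ∈ L, 0 < cm.2 → d ∣ φ cm.1) : d ∣ linZ L φ := by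
  induction L with
  | nil => simp [linZ]
  | cons a t ih =>
    rw [linZ_cons]
    refine dvd_add ?_ (ih fun cm hcm => h cm (List.mem_cons_of_mem _ hcm))
    rcases Nat.eq_zero_or_pos a.2 with h0 | hpos
    · simp [h0]
    · exact dvd_mul_of_dvd_right (h a List.mem_cons_self hpos) _

theorem Lz_add (D : Design) (φ ψ : Cell → ℤ) : Lz D (fun c => φ c + ψ c) = Lz D φ + Lz D ψ := by
  unfold Lz; rw [linZ_add, linZ_add]; ring
theorem Lz_sub (D : Design) (φ ψ : Cell → ℤ) : Lz D (fun c => φ c - ψ c) = Lz D φ - Lz D ψ := by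
  unfold Lz; rw [linZ_sub, linZ_sub]; ring
theorem Lz_mul (D : Design) (k : ℤ) (φ : Cell → ℤ) : Lz D (fun c => k * φ c) = k * Lz D φ := by
  unfold Lz; rw [linZ_mul, linZ_mul]; ring

theorem Tz_eq_Lz (D : Design) (w : Word) : D.Tz w = Lz D (fun c => icellCoef c w) := rfl

/-- real and imaginary parts of a weighted Gaussian sum. -/
theorem wsum_re (L : List (Cell × ℕ)) (u : Cell → GaussianInt) : (wsum L u).re = linZ L (fun c => (u c).re) := by
  induction L with
  | nil => simp [wsum, linZ]
  | cons a t ih =>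
    simp only [wsum, List.map_cons, List.sum_cons] at ih ⊢
    rw [linZ_cons, ← ih]
    simp [Zsqrtd.re_mul]
theorem wsum_im (L : List (Cell × ℕ)) (u : Cell → GaussianInt) : (wsum L u).im = linZ L (fun c => (u c).im) := by
  induction L with
  | nil => simp [wsum, linZ]
  | cons a t ih =>
    simp only [wsum, List.map_cons, List.sum_cons] at ih ⊢
    rw [linZ_cons, ← ih]
    simp [Zsqrtd.im_mul]

theorem T_re (D : Design) (w : Word) : (D.T w).re = Lz D (fun c => (cellCoef c w).re) := by
  rw [T_eq_Tf]; unfold Tf Lz; rw [Zsqrtd.re_sub, wsum_re, wsum_re]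
theorem T_im (D : Design) (w : Word) : (D.T w).im = Lz D (fun c => (cellCoef c w).im) := by
  rw [T_eq_Tf]; unfold Tf Lz; rw [Zsqrtd.im_sub, wsum_im, wsum_im]

/-- Support cells of an `OnAlphabet h` design have all four letters on the alphabet. -/
theorem onAlpha_N' (h : ℤ) (D : Design) (hA : D.OnAlphabet h) :
    ∀ cm ∈ D.N, 0 < cm.2 → ∀ f : Fin 4, (cm.1 f).OnAlphabet h := by
  intro cm hcm hpos f
  have hc : cm.1 ∈ D.suppN := (mem_suppN_iff D cm.1).mpr ⟨cm.2, hcm, hpos⟩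
  exact hA cm.1 (List.mem_append.mpr (Or.inl hc)) f
theorem onAlpha_P' (h : ℤ) (D : Design) (hA : D.OnAlphabet h) :
    ∀ cm ∈ D.P, 0 < cm.2 → ∀ f : Fin 4, (cm.1 f).OnAlphabet h := by
  intro cm hcm hpos f
  have hc : cm.1 ∈ D.suppP := (mem_suppP_iff D cm.1).mpr ⟨cm.2, hcm, hpos⟩
  exact hA cm.1 (List.mem_append.mpr (Or.inr hc)) f

/-- divisibility of `Lz` from cell-wise divisibility on alphabet cells. -/
theorem dvd_Lz (h : ℤ) (D : Design) (hA : D.OnAlphabet h) (φ : Cell → ℤ) (d : ℤ)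
    (hφ : ∀ c : Cell, (∀ f : Fin 4, (c f).OnAlphabet h) → d ∣ φ c) : d ∣ Lz D φ := by
  unfold Lz
  exact dvd_sub (dvd_linZ _ _ _ fun cm hcm hpos => hφ _ (onAlpha_N' h D hA cm hcm hpos))
    (dvd_linZ _ _ _ fun cm hcm hpos => hφ _ (onAlpha_P' h D hA cm hcm hpos))

/-! ## §5 The mixed rows kill the `x`- and `y`-moments -/

theorem X0_Y0_zero (D : Design) (h1 : D.A1) : Lz D (Xj pre0 0) = 0 ∧ Lz D (Yj pre0 0) = 0 := by
  have hz := (mixedE_zero D h1).1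
  have hr := T_re D wE0; have hi := T_im D wE0
  rw [hz] at hr hi; simp only [cellCoef_wE0] at hr hi
  have hi' : Lz D (fun c => - Yj pre0 0 c) = 0 := by simpa using hi.symm
  have e : Lz D (fun c => - Yj pre0 0 c) = - Lz D (Yj pre0 0) := by
    have := Lz_mul D (-1) (Yj pre0 0); simpa using this
  refine ⟨by simpa using hr.symm, ?_⟩
  rw [e] at hi'; simpa using hi'
theorem X1_Y1_zero (D : Design) (h1 : D.A1) : Lz D (Xj pre1 1) = 0 ∧ Lz D (Yj pre1 1) = 0 := by
  have hz := (mixedE_zero D h1).2.1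
  have hr := T_re D wPE; have hi := T_im D wPE
  rw [hz] at hr hi; simp only [cellCoef_wPE] at hr hi
  have hi' : Lz D (fun c => - Yj pre1 1 c) = 0 := by simpa using hi.symm
  have e : Lz D (fun c => - Yj pre1 1 c) = - Lz D (Yj pre1 1) := by
    have := Lz_mul D (-1) (Yj pre1 1); simpa using this
  refine ⟨by simpa using hr.symm, ?_⟩
  rw [e] at hi'; simpa using hi'
theorem X2_Y2_zero (D : Design) (h1 : D.A1) : Lz D (Xj pre2 2) = 0 ∧ Lz D (Yj pre2 2) = 0 := by
  have hz := (mixedE_zero D h1).2.2.1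
  have hr := T_re D wPPE; have hi := T_im D wPPE
  rw [hz] at hr hi; simp only [cellCoef_wPPE] at hr hi
  have hi' : Lz D (fun c => - Yj pre2 2 c) = 0 := by simpa using hi.symm
  have e : Lz D (fun c => - Yj pre2 2 c) = - Lz D (Yj pre2 2) := by
    have := Lz_mul D (-1) (Yj pre2 2); simpa using this
  refine ⟨by simpa using hr.symm, ?_⟩
  rw [e] at hi'; simpa using hi'
theorem X3_Y3_zero (D : Design) (h1 : D.A1) : Lz D (Xj pre3 3) = 0 ∧ Lz D (Yj pre3 3) = 0 := by
  have hz := (mixedE_zero D h1).2.2.2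
  have hr := T_re D wPPPE; have hi := T_im D wPPPE
  rw [hz] at hr hi; simp only [cellCoef_wPPPE] at hr hi
  have hi' : Lz D (fun c => - Yj pre3 3 c) = 0 := by simpa using hi.symm
  have e : Lz D (fun c => - Yj pre3 3 c) = - Lz D (Yj pre3 3) := by
    have := Lz_mul D (-1) (Yj pre3 3); simpa using this
  refine ⟨by simpa using hr.symm, ?_⟩
  rw [e] at hi'; simpa using hi'

/-! ## §6 Prefix-product divisibility and the odd-degree law -/

theorem dvd_pre1 (h : ℤ) (hh : (2 : ℤ) ∣ h) (c : Cell) (hc : ∀ f : Fin 4, (c f).OnAlphabet h) : (2 : ℤ) ∣ pre1 c :=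
  two_dvd_selfInt h hh _ (hc 0)
theorem dvd_pre2 (h : ℤ) (hh : (2 : ℤ) ∣ h) (c : Cell) (hc : ∀ f : Fin 4, (c f).OnAlphabet h) : (4 : ℤ) ∣ pre2 c := by
  have e : (4 : ℤ) = 2 * 2 := by norm_num
  rw [e]; exact mul_dvd_mul (two_dvd_selfInt h hh _ (hc 0)) (two_dvd_selfInt h hh _ (hc 1))
theorem dvd_pre3 (h : ℤ) (hh : (2 : ℤ) ∣ h) (c : Cell) (hc : ∀ f : Fin 4, (c f).OnAlphabet h) : (8 : ℤ) ∣ pre3 c := by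
  have e : (8 : ℤ) = 2 * 2 * 2 := by norm_num
  rw [e]; exact mul_dvd_mul (mul_dvd_mul (two_dvd_selfInt h hh _ (hc 0)) (two_dvd_selfInt h hh _ (hc 1)))
    (two_dvd_selfInt h hh _ (hc 2))

/-- The engine: if `2^j ∣ Π` on alphabet cells and the `x`-, `y`-moments of `Π` at slot `j` vanish, then `2^{j+1} ∣ Σ ν Π·a_j` at even `h`. -/
theorem odd_degree_engine (h : ℤ) (hh : (2 : ℤ) ∣ h) (D : Design) (hA : D.OnAlphabet h) (p : Cell → ℤ) (j : Fin 4) (k : ℤ)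
    (hp : ∀ c : Cell, (∀ f : Fin 4, (c f).OnAlphabet h) → k ∣ p c)
    (hX : Lz D (Xj p j) = 0) (hY : Lz D (Yj p j) = 0) : 2 * k ∣ Lz D (Aj p j) := by
  have e : Aj p j = fun c => ((Vj h p j c - Xj p j c) - Yj p j c) + h * p c := by
    funext c; rw [Aj_decomp h p j c]
  rw [e, Lz_add, Lz_sub, Lz_sub, hX, hY, Lz_mul, sub_zero, sub_zero]
  refine dvd_add ?_ ?_
  · refine dvd_Lz h D hA _ _ fun c hc => ?_
    unfold Vj
    have := mul_dvd_mul (hp c hc) (letter_parity h (c j) (hc j))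
    rw [mul_comm 2 k]; exact this
  · obtain ⟨h', rfl⟩ := hh
    rw [mul_assoc]
    exact mul_dvd_mul_left 2 (dvd_mul_of_dvd_right (dvd_Lz (2 * h') D hA _ _ hp) _)

/-- LAYER B, degree 1: `q₁ = T(h111) ∈ 2ℤ` at even height. -/
theorem two_dvd_q1 (h : ℤ) (hh : (2 : ℤ) ∣ h) (D : Design) (hA : D.OnAlphabet h) (h1 : D.A1) : (2 : ℤ) ∣ D.Tz wH0 := by
  obtain ⟨hX, hY⟩ := X0_Y0_zero D h1
  have e : D.Tz wH0 = Lz D (Aj pre0 0) := by rw [Tz_eq_Lz]; simp_rw [icellCoef_wH0]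
  have := odd_degree_engine h hh D hA pre0 0 1 (fun c _ => by simp [pre0]) hX hY
  rw [e]; simpa using this
/-- LAYER B, degree 3: `q₃ = T(ph11) ∈ 4ℤ` at even height. -/
theorem four_dvd_q3 (h : ℤ) (hh : (2 : ℤ) ∣ h) (D : Design) (hA : D.OnAlphabet h) (h1 : D.A1) : (4 : ℤ) ∣ D.Tz wPH := by
  obtain ⟨hX, hY⟩ := X1_Y1_zero D h1
  have e : D.Tz wPH = Lz D (Aj pre1 1) := by rw [Tz_eq_Lz]; simp_rw [icellCoef_wPH]
  have := odd_degree_engine h hh D hA pre1 1 2 (dvd_pre1 h hh) hX hY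
  rw [e]; simpa using this
/-- LAYER B, degree 5: `q₅ = T(pph1) ∈ 8ℤ` at even height. -/
theorem eight_dvd_q5 (h : ℤ) (hh : (2 : ℤ) ∣ h) (D : Design) (hA : D.OnAlphabet h) (h1 : D.A1) : (8 : ℤ) ∣ D.Tz wPPH := by
  obtain ⟨hX, hY⟩ := X2_Y2_zero D h1
  have e : D.Tz wPPH = Lz D (Aj pre2 2) := by rw [Tz_eq_Lz]; simp_rw [icellCoef_wPPH]
  have := odd_degree_engine h hh D hA pre2 2 4 (dvd_pre2 h hh) hX hY
  rw [e]; simpa using this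
/-- LAYER B, degree 7: `q₇ = T(ppph) ∈ 16ℤ` at even height. -/
theorem sixteen_dvd_q7 (h : ℤ) (hh : (2 : ℤ) ∣ h) (D : Design) (hA : D.OnAlphabet h) (h1 : D.A1) : (16 : ℤ) ∣ D.Tz wPPPH := by
  obtain ⟨hX, hY⟩ := X3_Y3_zero D h1
  have e : D.Tz wPPPH = Lz D (Aj pre3 3) := by rw [Tz_eq_Lz]; simp_rw [icellCoef_wPPPH]
  have := odd_degree_engine h hh D hA pre3 3 8 (dvd_pre3 h hh) hX hY
  rw [e]; simpa using this

/-- LAYER A, even degrees: `q₂ ∈ 2ℤ, q₄ ∈ 4ℤ, q₆ ∈ 8ℤ, q₈ ∈ 16ℤ` at even height (no mixed rows needed). -/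
theorem even_degree_law (h : ℤ) (hh : (2 : ℤ) ∣ h) (D : Design) (hA : D.OnAlphabet h) :
    (2 : ℤ) ∣ D.Tz wP ∧ (4 : ℤ) ∣ D.Tz wPP ∧ (8 : ℤ) ∣ D.Tz wPPP ∧ (16 : ℤ) ∣ D.Tz wPPPP := by
  refine ⟨?_, ?_, ?_, ?_⟩
  · rw [Tz_eq_Lz]; simp_rw [icellCoef_wP]; exact dvd_Lz h D hA _ _ (dvd_pre1 h hh)
  · rw [Tz_eq_Lz]; simp_rw [icellCoef_wPP]; exact dvd_Lz h D hA _ _ (dvd_pre2 h hh)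
  · rw [Tz_eq_Lz]; simp_rw [icellCoef_wPPP]; exact dvd_Lz h D hA _ _ (dvd_pre3 h hh)
  · rw [Tz_eq_Lz]; simp_rw [icellCoef_wPPPP]
    refine dvd_Lz h D hA _ _ fun c hc => ?_
    have e : (16 : ℤ) = 8 * 2 := by norm_num
    rw [e]; exact mul_dvd_mul (dvd_pre3 h hh c hc) (two_dvd_selfInt h hh _ (hc 3))

/-- Degree 1 at ANY height: `q₁ ≡ h · rank (mod 2)`. -/
theorem two_dvd_q1_sub (h : ℤ) (D : Design) (hA : D.OnAlphabet h) (h1 : D.A1) : (2 : ℤ) ∣ D.Tz wH0 - h * D.rank := by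
  obtain ⟨hX, hY⟩ := X0_Y0_zero D h1
  have e : D.Tz wH0 = Lz D (Aj pre0 0) := by rw [Tz_eq_Lz]; simp_rw [icellCoef_wH0]
  have e2 : Aj pre0 0 = fun c => ((Vj h pre0 0 c - Xj pre0 0 c) - Yj pre0 0 c) + h * pre0 c := by
    funext c; rw [Aj_decomp h pre0 0 c]
  have er : D.rank = Lz D pre0 := by
    unfold Design.rank Lz linZ pre0; simp [Function.comp_def]
  rw [e, e2, Lz_add, Lz_sub, Lz_sub, hX, hY, Lz_mul, sub_zero, sub_zero, er, add_sub_cancel_right]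
  exact dvd_Lz h D hA _ _ fun c hc => by unfold Vj pre0; simpa using letter_parity h (c 0) (hc 0)

/-! ## §7 The slot lattice as an S⁺-shaped `Prop`, and the orbit-sum row the multiset model lacks -/

/-- SLOT LATTICE at height `h`: `q_d ∈ 2^⌈d/2⌉ ℤ` for `d = 1 … 8`, on the canonical placements (all placements agree by (A1).2, `Tz_eq_of_A1`). -/
def SlotLattice (h : ℤ) : Prop := ∀ D : Design, D.OnAlphabet h → D.A1 →
  (2 : ℤ) ∣ D.Tz wH0 ∧ (2 : ℤ) ∣ D.Tz wP ∧ (4 : ℤ) ∣ D.Tz wPH ∧ (4 : ℤ) ∣ D.Tz wPP ∧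
  (8 : ℤ) ∣ D.Tz wPPH ∧ (8 : ℤ) ∣ D.Tz wPPP ∧ (16 : ℤ) ∣ D.Tz wPPPH ∧ (16 : ℤ) ∣ D.Tz wPPPP

theorem slotLattice_holds (h : ℤ) (hh : (2 : ℤ) ∣ h) : SlotLattice h := fun D hA h1 =>
  ⟨two_dvd_q1 h hh D hA h1, (even_degree_law h hh D hA).1, four_dvd_q3 h hh D hA h1, (even_degree_law h hh D hA).2.1,
    eight_dvd_q5 h hh D hA h1, (even_degree_law h hh D hA).2.2.1, sixteen_dvd_q7 h hh D hA h1, (even_degree_law h hh D hA).2.2.2⟩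

theorem slotLattice_six : SlotLattice 6 := slotLattice_holds 6 ⟨3, by norm_num⟩
theorem slotLattice_fourteen : SlotLattice 14 := slotLattice_holds 14 ⟨7, by norm_num⟩

/-- The level-sum functional `Σ_f a_f` of a cell — the degree-1 multiset row `S_{111h}` of the orbit-summed class model. -/
def levelSum (c : Cell) : ℤ := (c 0).a + (c 1).a + (c 2).a + (c 3).a

theorem levelSum_eq (c : Cell) : levelSum c = icellCoef c wH0 + icellCoef c wH1 + icellCoef c wH2 + icellCoef c wH3 := by
  unfold levelSum icellCoef wH0 wH1 wH2 wH3; simp [Fin.prod_univ_four, Sym.icoef]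

/-- SLOT AGREEMENT (any height, no parity): the orbit-summed degree-1 row is `4·q₁`. -/
theorem levelSum_eq_four_mul (D : Design) (h1 : D.A1) : Lz D levelSum = 4 * D.Tz wH0 := by
  have e : levelSum = fun c => ((icellCoef c wH0 + icellCoef c wH1) + icellCoef c wH2) + icellCoef c wH3 := by
    funext c; rw [levelSum_eq]
  rw [e, Lz_add, Lz_add, Lz_add, ← Tz_eq_Lz, ← Tz_eq_Lz, ← Tz_eq_Lz, ← Tz_eq_Lz,
    Tz_eq_of_A1 D h1 wH1 wH0 wH1_efree wH0_efree (by rw [wH1_deg, wH0_deg]),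
    Tz_eq_of_A1 D h1 wH2 wH0 wH2_efree wH0_efree (by rw [wH2_deg, wH0_deg]),
    Tz_eq_of_A1 D h1 wH3 wH0 wH3_efree wH0_efree (by rw [wH3_deg, wH0_deg])]
  ring

theorem four_dvd_levelSum (D : Design) (h1 : D.A1) : (4 : ℤ) ∣ Lz D levelSum := by
  rw [levelSum_eq_four_mul D h1]; exact dvd_mul_right 4 _

/-- … and `8 ∣ Σ ν (a₀+a₁+a₂+a₃)` at even height (LAYER B). -/
theorem eight_dvd_levelSum (h : ℤ) (hh : (2 : ℤ) ∣ h) (D : Design) (hA : D.OnAlphabet h) (h1 : D.A1) :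
    (8 : ℤ) ∣ Lz D levelSum := by
  rw [levelSum_eq_four_mul D h1]
  have e : (8 : ℤ) = 4 * 2 := by norm_num
  rw [e]; exact mul_dvd_mul_left 4 (two_dvd_q1 h hh D hA h1)

/-! ## §8 The 175-point of region 4273 (idea-crit-hsem-4 g9 memo-105) is not an orbit sum of an integer slot-resolved design -/

/-- The 175-point as (level multiset, count) data: P columns `a²f² ×28, a²rf ×19, a m³ ×9, b⁴ ×6, a²ru ×2`, N columns `a b³ ×89, H²(5;1,0)b ×8,
(4;2,0)a(2;4,0)² ×5, H²(3;2,1)(2;3,1) ×2, H(5;1,0)²b ×2, H³(2;3,1), H³b, H²(4;2,0)(3;2,1), H²(4;1,1)b, H²(3;2,1)b ×1`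
(levels: a = (4;1,1) ↦ 4, f = (0;5,1) ↦ 0, r = (2;3,1) ↦ 2, u = (1;4,1) ↦ 1, m = (0;3,3) ↦ 0, b = (2;2,2) ↦ 2, H = (6;0,0) ↦ 6, (5;1,0) ↦ 5, …). -/
def levels175P : List ((ℤ × ℤ × ℤ × ℤ) × ℤ) :=
  [((4,4,0,0), 28), ((4,4,2,0), 19), ((4,0,0,0), 9), ((2,2,2,2), 6), ((4,4,2,1), 2)]
def levels175N : List ((ℤ × ℤ × ℤ × ℤ) × ℤ) :=
  [((4,2,2,2), 89), ((6,6,5,2), 8), ((4,4,2,2), 5), ((6,6,3,2), 2), ((6,5,5,2), 2), ((6,6,6,2), 1), ((6,6,6,2), 1),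
   ((6,6,4,3), 1), ((6,6,4,2), 1), ((6,6,3,2), 1)]
/-- signed level-sum functional of such data: `Σ_N count·(Σ levels) − Σ_P count·(Σ levels)`. -/
def levelSumData (N P : List ((ℤ × ℤ × ℤ × ℤ) × ℤ)) : ℤ :=
  (N.map fun e => e.2 * (e.1.1 + e.1.2.1 + e.1.2.2.1 + e.1.2.2.2)).sum - (P.map fun e => e.2 * (e.1.1 + e.1.2.1 + e.1.2.2.1 + e.1.2.2.2)).sum

theorem copies175 : (levels175N.map Prod.snd).sum = 111 ∧ (levels175P.map Prod.snd).sum = 64 := by decide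
theorem levelSum175 : levelSumData levels175N levels175P = 746 := by decide
theorem not_four_dvd_746 : ¬ (4 : ℤ) ∣ 746 := by decide

/-- Hence no integer slot-resolved (A1)-design (any alphabet, any signs, any slot order) has orbit-summed level-sum functional `746`: the 175-point
is a point of the multiset relaxation only. -/
theorem no_design_has_levelSum_746 (D : Design) (h1 : D.A1) : Lz D levelSum ≠ 746 := by
  intro h746
  exact not_four_dvd_746 (h746 ▸ four_dvd_levelSum D h1)

/-- The thirteen T13 least points (memo-106) by their degree-1 functional `S_{111h}`: twelve are not in `4ℤ`, the 4277 point (`604 = 4·151`) is in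
`4ℤ ∖ 8ℤ` — excluded at even height by `eight_dvd_levelSum`. -/
theorem t13_levelSums :
    (∀ s ∈ ([746, 982, 355, 689, 997, 647, 205, 778, 1109, 651, 1903, 1258] : List ℤ), ¬ (4 : ℤ) ∣ s) ∧ ¬ (8 : ℤ) ∣ (604 : ℤ) := by decide

theorem no_design_has_levelSum_604 (h : ℤ) (hh : (2 : ℤ) ∣ h) (D : Design) (hA : D.OnAlphabet h) (h1 : D.A1) : Lz D levelSum ≠ 604 := by
  intro h604
  exact t13_levelSums.2 (h604 ▸ eight_dvd_levelSum h hh D hA h1)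

end Summit.HodgeConjecture.HodgeConjecture.Cruxes.BlochSeedDiscOne.SlotLatticeLaw
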